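import Summits.ABC.IUTFork.Joshi.TestGenuinePinsLinkPin
import Summits.ABC.IUTFork.Joshi.TestRealPinsIsometricCriterionIff
import HarnessLib

/-!
# Branch E TEST — THE LINK PIN (pL) AT THE SECOND GENUINE CARRIER `honestSetting` IS DERIVABLE OUTRIGHT (E-ROW R-65, addendum)

Proof-only companion (abc-iut cell, D-0079 R-J «Joshi Y-discharge census», E-ROW R-65 lineage; seat abc-iut-E-t42, gen 9; 0 definitions, 0
instances, no `Prop` fact, FACT rows used: none; everything BY NAME) to `Joshi/TestGenuinePinsLinkPin.lean` (p524016: at abc-iut-c312-7's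
`settingPrVolSharp` the link pin is DATUM-DEPENDENT, residual binder `Nonempty (Ob sig.Clgp ≃ ObΔ)`, because the context data `sig`/`split`/`qData`
are free binders there).  THE OTHER GENUINE CARRIER of the lane — abc-iut-E-t41's `honestSetting` over `latticeSituationReal` (`Joshi/TestRealHonestPacket`,
the carrier of rows Y-12 / Y-29b and of E-ROW R-63) — FIXES the context data to abc-iut-c312-5's one-point `unitSigDH`/`unitSplitDH`/`unitQDataDH`,
so there the question of R-65 has the opposite, unconditional answer:

* **`linkPinned_honestSetting`** — `LinkPinned (latticeSituationReal …) (honestSetting …)` for EVERY `X hlog Aut Ism … col n p`: DERIVABLE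
  (both object types are `Unit`; `GenuinePinsLinkPin.pilotLink_of_equiv`); likewise c312-5's unit setting `linkPinned_settingDHVolUnit`.
* **`pinnedRegions3_honestSetting_iff`** — at the honest carrier THREE PINS ⟺ TWO PINS (`PinnedRegions3 … ρ qK ↔ PinnedRegions … ρ qK`), and the
  `∃ ρ qK` form `exists_pinnedRegions3_honestSetting_iff`: every INHABITED-side theorem of record at this carrier (abc-iut-E-t41 p460152…, this
  seat's gens 4–6, abc-iut-E-t47's criterion) is a three-pin theorem for free, and every `not_pinnedRegions3_honestSetting_…` of record was the
  two-pin statement already.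
* **`exists_pinnedRegions3_honestSetting_iff_forall_place'`** — abc-iut-E-t47's R-25 pins-level BICONDITIONAL of rows Y-12 / Y-29b (p494679
  `PinsIsometricCriterionIff.exists_pinnedRegions_honestSetting_iff_forall_place'`, [IUTchIV] Prop. 1.2 currency: INHABITED under the isometric (Ind2)
  `↔ ∀ p₀, ∀ v ∋ p₀, p₀ ∤ e(v|p₀) ∨ (p₀ = 2 ∧ f(v|p₀) = 1 ∧ ord_v 𝔇 = e(v|p₀))`) restated VERBATIM for `PinnedRegions3` — same binders, no link
  hypothesis.

READING (tree currency; located, not adjudicated; COUNT-NEUTRAL for Y-12 / Y-26 / Y-29b / Y-31).  The contrast is structural, not arithmetical: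
`settingPrVolSharp` quantifies over the Frobenioid context, `honestSetting` instantiates it at a point; the typed (pL) reads only that context
(p524016 §1).  **No side is taken** on [IUTchIII] Cor. 3.12 / [IUTchIV] Thm. 1.10 or on any author (Mochizuki / Scholze–Stix / Joshi /
Dupuy–Hilado); typed ≠ proved; instantiated ≠ endorsed; NOT an abc claim. [claim: Mochizuki2012, status: disputed] [cite: DupuyHilado2025, §4.7, §4.9]
-/

noncomputable section

open Set Function NumberField IsDedekindDomain
open scoped Pointwise Classical

namespace Summit.ABC.IUTFork.Joshi

namespace HonestPinsLinkPin

open Thm311 Thm311.Real Cor312 Cor312Vol Literature.IUT.LogThetaLattice Literature.IUT.LogVolume GenuinePinsLinkPin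
  PinsIsometricCriterionIff

/-! ## 1. abc-iut-c312-5's unit setting over `situationDHVol`: link pin derivable -/

section UnitSetting

variable {F : Type} [Field F] [NumberField F] (X : PilotData F) {logv : PadicLogs F} (hlog : LogvAnalytic logv)
  (M : Type) [Field M] [NumberField M]
  (archPk : ∀ (j : (thetaIndex X).Label) (vQ : (thetaIndex X).VQ), Set ((logShellsDH X logv).Packet j vQ))
  (archSub : ∀ (j : (thetaIndex X).Label) (v : (thetaIndex X).V),
    Set ((logShellsDH X logv).Packet j ((thetaIndex X).over v)))
  (Ψ : ℤ → ∀ v : (thetaIndex X).V, v ∈ (thetaIndex X).Vbad → Set ((logShellsDH X logv).StarPacket v))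
  (act : ℤ → ∀ v : (thetaIndex X).V, v ∈ (thetaIndex X).Vbad →
    (logShellsDH X logv).StarPacket v → Module.End ℚ ((logShellsDH X logv).StarPacket v))
  (Mmod : ℤ → ∀ j : (thetaIndex X).LabelStar, Set ((logShellsDH X logv).GlobalPacket j.1))
  (region : ℤ → ∀ j : (thetaIndex X).LabelStar, FinDivisor M → ∀ vQ : (thetaIndex X).VQ,
    Set ((logShellsDH X logv).Packet j.1 vQ))
  (n : ℤ) (col : ℤ → Column (logShellsDH X logv))

/-- **(pL) at abc-iut-c312-5's UNIT SETTING `settingDHVolUnit` is DERIVABLE**: its context data are the one-point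
`unitSigDH`/`unitSplitDH`/`unitQDataDH`, both object types are `Unit`. [claim: Mochizuki2012, status: disputed] -/
theorem linkPinned_settingDHVolUnit :
    LinkPinned ({ toSituation := situationDHVol X hlog M archPk archSub Ψ act Mmod region, col := col } : LatticeSituation (thetaIndex X))
      (settingDHVolUnit X hlog M archPk archSub Ψ act Mmod region n) :=
  pilotLink_of_equiv _ (Equiv.refl Unit)

end UnitSetting

/-! ## 2. The honest carrier `honestSetting` over `latticeSituationReal`: link pin derivable, three pins ⟺ two pins -/

section Honest

variable {F : Type} [Field F] [NumberField F] (X : PilotData F) {logv : PadicLogs F} (hlog : LogvAnalytic logv)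
  (Aut Ism : ∀ x : Thm311.Real.Place F, Set (Carrier x ≃ₗ[ℚ] Carrier x))
  (hAut : ∀ x, LinearEquiv.refl ℚ (Carrier x) ∈ Aut x) (hIsm : ∀ x, LinearEquiv.refl ℚ (Carrier x) ∈ Ism x)
  (M : Type) [Field M] [NumberField M]
  (archPk : ∀ (j : (thetaIndex X).Label) (vQ : (thetaIndex X).VQ), Set ((logShells X logv Aut Ism hAut hIsm).Packet j vQ))
  (archSub : ∀ (j : (thetaIndex X).Label) (v : (thetaIndex X).V),
    Set ((logShells X logv Aut Ism hAut hIsm).Packet j ((thetaIndex X).over v)))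
  (Ψ : ℤ → ∀ v : (thetaIndex X).V, v ∈ (thetaIndex X).Vbad → Set ((logShells X logv Aut Ism hAut hIsm).StarPacket v))
  (act : ℤ → ∀ v : (thetaIndex X).V, v ∈ (thetaIndex X).Vbad →
    (logShells X logv Aut Ism hAut hIsm).StarPacket v → Module.End ℚ ((logShells X logv Aut Ism hAut hIsm).StarPacket v))
  (Mmod : ℤ → ∀ j : (thetaIndex X).LabelStar, Set ((logShells X logv Aut Ism hAut hIsm).GlobalPacket j.1))
  (region : ℤ → ∀ j : (thetaIndex X).LabelStar, FinDivisor M → ∀ vQ : (thetaIndex X).VQ,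
    Set ((logShells X logv Aut Ism hAut hIsm).Packet j.1 vQ))
  (col : ℤ → Column (logShells X logv Aut Ism hAut hIsm)) (n : ℤ) (p : ℕ) [hp : Fact p.Prime]

omit hp in
/-- **(pL) at the HONEST CARRIER is DERIVABLE**, for every `X hlog Aut Ism … col n p`: `honestSetting` instantiates the Frobenioid context at
abc-iut-c312-5's one-point data, so `Ob sig.Clgp = ObΔ = Unit` and p524016's residual binder is inhabited by `Equiv.refl Unit`.
[claim: Mochizuki2012, status: disputed] -/
theorem linkPinned_honestSetting :
    LinkPinned (latticeSituationReal X hlog Aut Ism hAut hIsm M archPk archSub Ψ act Mmod region col)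
      (honestSetting X hlog Aut Ism hAut hIsm M archPk archSub Ψ act Mmod region col n p) :=
  pilotLink_of_equiv _ (Equiv.refl Unit)

omit hp in
/-- **At the honest carrier THREE PINS ⟺ TWO PINS** (`PinnedRegions3 ↔ PinnedRegions`), for every `ρ`, `qK`. [claim: Mochizuki2012, status: disputed] -/
theorem pinnedRegions3_honestSetting_iff
    (ρ : (∀ v : (thetaIndex X).V, v ∈ (thetaIndex X).Vbad → Set ((logShells X logv Aut Ism hAut hIsm).StarPacket v)) →
      ∀ (j : (thetaIndex X).Label) (vQ : (thetaIndex X).VQ), Set ((logShells X logv Aut Ism hAut hIsm).Packet j vQ))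
    (qK : ∀ v : (thetaIndex X).V, v ∈ (thetaIndex X).Vbad → Set ((logShells X logv Aut Ism hAut hIsm).StarPacket v)) :
    PinnedRegions3 (latticeSituationReal X hlog Aut Ism hAut hIsm M archPk archSub Ψ act Mmod region col)
        (honestSetting X hlog Aut Ism hAut hIsm M archPk archSub Ψ act Mmod region col n p) ρ qK ↔
      PinnedRegions (latticeSituationReal X hlog Aut Ism hAut hIsm M archPk archSub Ψ act Mmod region col)
        (honestSetting X hlog Aut Ism hAut hIsm M archPk archSub Ψ act Mmod region col n p) ρ qK :=
  and_iff_left (linkPinned_honestSetting X hlog Aut Ism hAut hIsm M archPk archSub Ψ act Mmod region col n p)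

omit hp in
/-- … and in the `∃ ρ qK` form: INHABITED with three pins ⟺ INHABITED with two. [claim: Mochizuki2012, status: disputed] -/
theorem exists_pinnedRegions3_honestSetting_iff :
    (∃ (ρ : (∀ v : (thetaIndex X).V, v ∈ (thetaIndex X).Vbad → Set ((logShells X logv Aut Ism hAut hIsm).StarPacket v)) →
          ∀ (j : (thetaIndex X).Label) (vQ : (thetaIndex X).VQ), Set ((logShells X logv Aut Ism hAut hIsm).Packet j vQ))
      (qK : ∀ v : (thetaIndex X).V, v ∈ (thetaIndex X).Vbad → Set ((logShells X logv Aut Ism hAut hIsm).StarPacket v)),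
      PinnedRegions3 (latticeSituationReal X hlog Aut Ism hAut hIsm M archPk archSub Ψ act Mmod region col)
        (honestSetting X hlog Aut Ism hAut hIsm M archPk archSub Ψ act Mmod region col n p) ρ qK) ↔
    ∃ (ρ : (∀ v : (thetaIndex X).V, v ∈ (thetaIndex X).Vbad → Set ((logShells X logv Aut Ism hAut hIsm).StarPacket v)) →
          ∀ (j : (thetaIndex X).Label) (vQ : (thetaIndex X).VQ), Set ((logShells X logv Aut Ism hAut hIsm).Packet j vQ))
      (qK : ∀ v : (thetaIndex X).V, v ∈ (thetaIndex X).Vbad → Set ((logShells X logv Aut Ism hAut hIsm).StarPacket v)),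
      PinnedRegions (latticeSituationReal X hlog Aut Ism hAut hIsm M archPk archSub Ψ act Mmod region col)
        (honestSetting X hlog Aut Ism hAut hIsm M archPk archSub Ψ act Mmod region col n p) ρ qK := by
  simp only [pinnedRegions3_honestSetting_iff]

omit hp in
/-- The universal negative forms agree too: EMPTY with three pins for every `(ρ, qK)` ⟺ EMPTY with two. [claim: Mochizuki2012, status: disputed] -/
theorem forall_not_pinnedRegions3_honestSetting_iff :
    (∀ (ρ : (∀ v : (thetaIndex X).V, v ∈ (thetaIndex X).Vbad → Set ((logShells X logv Aut Ism hAut hIsm).StarPacket v)) →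
          ∀ (j : (thetaIndex X).Label) (vQ : (thetaIndex X).VQ), Set ((logShells X logv Aut Ism hAut hIsm).Packet j vQ))
      (qK : ∀ v : (thetaIndex X).V, v ∈ (thetaIndex X).Vbad → Set ((logShells X logv Aut Ism hAut hIsm).StarPacket v)),
      ¬ PinnedRegions3 (latticeSituationReal X hlog Aut Ism hAut hIsm M archPk archSub Ψ act Mmod region col)
        (honestSetting X hlog Aut Ism hAut hIsm M archPk archSub Ψ act Mmod region col n p) ρ qK) ↔
    ∀ (ρ : (∀ v : (thetaIndex X).V, v ∈ (thetaIndex X).Vbad → Set ((logShells X logv Aut Ism hAut hIsm).StarPacket v)) →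
          ∀ (j : (thetaIndex X).Label) (vQ : (thetaIndex X).VQ), Set ((logShells X logv Aut Ism hAut hIsm).Packet j vQ))
      (qK : ∀ v : (thetaIndex X).V, v ∈ (thetaIndex X).Vbad → Set ((logShells X logv Aut Ism hAut hIsm).StarPacket v)),
      ¬ PinnedRegions (latticeSituationReal X hlog Aut Ism hAut hIsm M archPk archSub Ψ act Mmod region col)
        (honestSetting X hlog Aut Ism hAut hIsm M archPk archSub Ψ act Mmod region col n p) ρ qK := by
  simp only [pinnedRegions3_honestSetting_iff]

/-- **abc-iut-E-t47's R-25 BICONDITIONAL (rows Y-12 / Y-29b) in THREE-PIN form, [IUTchIV] Prop. 1.2 currency** — p494679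
`exists_pinnedRegions_honestSetting_iff_forall_place'` restated VERBATIM for `PinnedRegions3` (same symmetric-binder / bad-prime-proviso hypotheses):
INHABITED under the isometric (Ind2) `↔ ∀ p₀, ∀ v ∋ p₀, p₀ ∤ e(v|p₀) ∨ (p₀ = 2 ∧ f(v|p₀) = 1 ∧ ord_v 𝔇_{F/ℤ} = e(v|p₀))`.
[claim: Mochizuki2012, status: disputed] [cite: DupuyHilado2025, §4.7, §4.9] [cite: Mochizuki2012, IUTchIV Prop. 1.2 p. 10] -/
theorem exists_pinnedRegions3_honestSetting_iff_forall_place'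
    (hAutT : ∀ x, ∀ g ∈ Aut x, g = LinearEquiv.refl ℚ (Carrier x))
    (hIsmI : ∀ (pp : Nat.Primes) (x : (thetaIndex X).Fibre (.inr pp)), ∀ g ∈ Ism x.1,
      haveI : Fact (pp : ℕ).Prime := ⟨pp.2⟩
      ∃ g' : (presAt X hlog pp).k x ≃ₗ[ℚ_[pp]] (presAt X hlog pp).k x,
        (∀ a, (presAt X hlog pp).φ x (g a) = g' ((presAt X hlog pp).φ x a)) ∧ ∀ y, ‖g' y‖ = ‖y‖)
    (hIsmS : ∀ (pp : Nat.Primes) (w : HeightOneSpectrum (𝓞 F)) (hw : (thetaIndex X).over (.inr w) = .inr pp),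
      haveI : Fact (pp : ℕ).Prime := ⟨pp.2⟩
      ∀ G : (presAt X hlog pp).k ⟨.inr w, hw⟩ ≃ₗ[ℚ_[pp]] (presAt X hlog pp).k ⟨.inr w, hw⟩, (∀ a, ‖G a‖ = ‖a‖) →
        ∃ g ∈ Ism (.inr w), ∀ a, (presAt X hlog pp).φ ⟨.inr w, hw⟩ (g a) = G ((presAt X hlog pp).φ ⟨.inr w, hw⟩ a))
    (hbadGood : ∀ (pp : Nat.Primes), (∃ v' ∈ (thetaIndex X).Vbad, (thetaIndex X).over v' = .inr pp) →
      ∀ v : HeightOneSpectrum (𝓞 F), ((pp : ℕ) : 𝓞 F) ∈ v.asIdeal →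
        ¬ (pp : ℕ) ∣ v.asIdeal.ramificationIdx ℤ ∨
          ((pp : ℕ) = 2 ∧ v.asIdeal.inertiaDeg ℤ = 1 ∧
            multiplicity v.asIdeal (differentIdeal ℤ (𝓞 F)) = v.asIdeal.ramificationIdx ℤ)) :
    (∃ (ρ : (∀ v : (thetaIndex X).V, v ∈ (thetaIndex X).Vbad → Set ((logShells X logv Aut Ism hAut hIsm).StarPacket v)) →
          ∀ (j : (thetaIndex X).Label) (vQ : (thetaIndex X).VQ), Set ((logShells X logv Aut Ism hAut hIsm).Packet j vQ))
      (qK : ∀ v : (thetaIndex X).V, v ∈ (thetaIndex X).Vbad → Set ((logShells X logv Aut Ism hAut hIsm).StarPacket v)),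
      PinnedRegions3 (latticeSituationReal X hlog Aut Ism hAut hIsm M archPk archSub Ψ act Mmod region col)
        (honestSetting X hlog Aut Ism hAut hIsm M archPk archSub Ψ act Mmod region col n p) ρ qK) ↔
    (∀ (pp : Nat.Primes) (v : HeightOneSpectrum (𝓞 F)), ((pp : ℕ) : 𝓞 F) ∈ v.asIdeal →
      ¬ (pp : ℕ) ∣ v.asIdeal.ramificationIdx ℤ ∨
        ((pp : ℕ) = 2 ∧ v.asIdeal.inertiaDeg ℤ = 1 ∧
          multiplicity v.asIdeal (differentIdeal ℤ (𝓞 F)) = v.asIdeal.ramificationIdx ℤ)) := by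
  rw [exists_pinnedRegions3_honestSetting_iff]
  exact exists_pinnedRegions_honestSetting_iff_forall_place' X hlog hAut hIsm M archPk archSub Ψ act Mmod region col n p hAutT hIsmI
    hIsmS hbadGood

end Honest

end HonestPinsLinkPin

end Summit.ABC.IUTFork.Joshi

end
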